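import Literature.AlgebraicGeometry.ShimuraVarieties.UnitaryBallQuotientKaehlerDatum
import Literature.AlgebraicGeometry.ShimuraVarieties.UnitaryBallLevelFiniteCover
import Literature.AlgebraicGeometry.ShimuraVarieties.UnitaryBallClassLiftTranslate
import HarnessLib

/-!
# Pull-backs of the Kähler–rational class of a compact ball quotient are Kähler

Layer `Literature/AlgebraicGeometry/ShimuraVarieties`; sequel of `UnitaryBallQuotientKaehlerDatum` (the
cover-stable Kähler–rational datum `exists_kaehlerRationalDatum_map_eq`). PROVED here (theorems only; no
definitions, no named facts):

* `BallFS.immersive_smul_comp` / `BallFS.immersive_twist` — **the twist of an immersive system is immersive**: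
  if the projective system `G : 𝔹² → ℂᴺ⁺¹` of weight `k` for `Δ₂` is immersive at some lift of every point of
  `Δ₂\𝔹²` (kernel form `dG_z u ∈ ℂ · G z ⟹ u = 0`), then it is immersive at EVERY point of `𝔹²` (automorphy
  `G = j(δ, ·)ᵏ • (G ∘ δ)` and the Leibniz rule), and so is the twisted system `S_g G = j(g, ·)ᵏ • (G ∘ g)` for
  `g ∈ U(2,1)` (`d(S_g G)_z u = j(g,z)ᵏ dG_{gz}(dg_z u) + (d jᵏ)_z(u) G(gz)`, `dg_z` injective);
* `UnitaryBallUniformisationDatum.isKaehlerClass_map_of_anMap_eq` — for a morphism `f : X₁ ⟶ X₂` of compact ball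
  quotients whose analytification lifts to the translation `z ↦ g z`, and the Kähler–rational datum `K` of an
  immersive system `G` on `X₂` (`exists_kaehlerRationalDatum_fsForm`), the class `f(ℂ)^*(K.η ⊗ 1)` is a KÄHLER class
  of `X₁`: it compares to `r · [[S_g G]^*ω_FS]`, the Kähler form of a Kähler metric (Voisin I §3.3.2 Lemma 3.16);
* `UnitaryBallUniformisationDatum.frameIso_conj_mem_ballImage`, `….anMap_quotModel_mk` — bookkeeping: a matrix
  `g ∈ U(H^{τ₁})` conjugating `Γ₁^{τ₁}` into `Γ₂^{τ₁}` and a morphism with `f(ℂ)(unif₁ v) = unif₂ (g v)` on the cone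
  give `ĝ = T⁻¹ g T ∈ U(2,1)` conjugating the ball images and `f^an (Δ₁ z) = Δ₂ (ĝ z)`;
* **`UnitaryBallUniformisationDatum.exists_kaehlerRationalDatum_pull`** — THE PINNED KÄHLER CLASS SYSTEM: for a
  compact ball-quotient datum `𝒟` on `X` (`p = 2`) there is a Kähler–rational datum `K` of `X` such that for every
  datum `𝒟₁` on `X₁` with the same Gram matrix and every morphism `f : X₁ ⟶ X` lying over `v ↦ g v`, `g ∈ U(H^{τ₁})`
  conjugating `Γ₁^{τ₁}` into `Γ^{τ₁}`: (i) `f^*(K.η ⊗ 1)` is a Kähler class of `X₁`; (ii) `f^* K.η = f'^* K.η` for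
  any second such `f'` (over `v ↦ g' v`). With `ω_{X₁} := f^* K.η` this is the Kähler class system of the levels
  below `X` in a tower of Picard modular surfaces (level coverings `g = 1`, Hecke translates `g = γ^{ι₁}`).

## References

* C. Voisin, *Hodge Theory and Complex Algebraic Geometry I* (2002), §2.2.1, §3.1.1 Lemma 3.3, §3.1.3, §3.3.2
  Lemma 3.16, §7.1.2. [VoisinHodgeI2002]
* I. R. Shafarevich, *Basic Algebraic Geometry 2* (Springer 1994), Ch. VIII §1.2, Ch. IX §3.1–3.2. [Shafarevich1994]
* G. Shimura, *Introduction to the Arithmetic Theory of Automorphic Functions* (1971), §3.1 Prop. 3.1, §7.2–7.3. [Shimura1971]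
* P. Griffiths, J. Harris, *Principles of Algebraic Geometry* (1978), Ch. 0 §2, Ch. 1 §2. [GriffithsHarrisPrinciples1978]

## Provenance

hodgecm-mathlib cell, typer seat B-typ03 (row B3-25 (b2), tower edition): the debt-0 derivation of the
Kähler-class-system input of the Picard tower from the kernel sources of lane KAEHLER-HECKE-INV (b10).
Everything here is kernel-checked; no named facts.
-/

set_option autoImplicit false

noncomputable section

open scoped Manifold ContDiff Topology InnerProductSpace ComplexConjugate Matrix
open Set Function MulAction Filter Complex
open Literature.Geometry.ComplexHyperbolic
open Literature.Geometry.ComplexHyperbolic.BallModel (U21 Ball)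
open Literature.Geometry.Manifold
open Literature.Geometry.Kaehler
open Literature.Topology.FourManifolds
open Literature.NumberTheory.Automorphic.AutomorphyFactor

namespace Literature.AlgebraicGeometry.ShimuraVarieties

/-! ### Immersivity of a projective system is inherited by its twists -/

namespace BallFS

open BallForms (canonicalFactor canonicalCocycle canonicalFactor_ne_zero)
open BallDescent (isHolCocycle_canonicalFactor_pow)

variable {N k : ℕ}

/-- The differential of a translation `z ↦ g z` of the ball is injective (`g⁻¹ ∘ g = id`).
[cite: Shafarevich1994, Ch. VIII §1.2 (8.8)] -/
theorem injective_mfderiv_smul (g : U21) (z : Ball) :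
    Injective (mfderiv 𝓘(ℂ, Fin 2 → ℂ) 𝓘(ℂ, Fin 2 → ℂ) (fun w : Ball ↦ g • w) z) := by
  have hd : ∀ h : U21, MDifferentiable 𝓘(ℂ, Fin 2 → ℂ) 𝓘(ℂ, Fin 2 → ℂ) (fun w : Ball ↦ h • w) := fun h ↦
    (BallModel.contMDiff_smul h (n := ω)).mdifferentiable (by simp)
  have hcomp : ((fun w : Ball ↦ g⁻¹ • w) ∘ fun w : Ball ↦ g • w) = id := funext fun w ↦ inv_smul_smul g w
  have h1 : mfderiv 𝓘(ℂ, Fin 2 → ℂ) 𝓘(ℂ, Fin 2 → ℂ) ((fun w : Ball ↦ g⁻¹ • w) ∘ fun w : Ball ↦ g • w) z =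
      ContinuousLinearMap.id ℂ _ := by
    rw [hcomp, mfderiv_id]
  have h2 := mfderiv_comp z (hd g⁻¹ (g • z)) (hd g z)
  intro u v huv
  have h := congrArg (fun x ↦ mfderiv 𝓘(ℂ, Fin 2 → ℂ) 𝓘(ℂ, Fin 2 → ℂ) (fun w : Ball ↦ g⁻¹ • w) (g • z) x) huv
  change (mfderiv _ _ _ _).comp (mfderiv _ _ _ _) u = (mfderiv _ _ _ _).comp (mfderiv _ _ _ _) v at h
  rwa [← h2, h1] at h

/-- **Leibniz rule for the kernel condition.** If `φ : 𝔹² → 𝔹²` has injective differential at `z`, `c` is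
holomorphic with `c z ≠ 0`, and `G` is immersive at `φ z` (`dG_{φ z} v ∈ ℂ · G(φ z) ⟹ v = 0`), then
`c • (G ∘ φ)` is immersive at `z`: `d(c • G ∘ φ)_z u = c z • dG_{φ z}(dφ_z u) + dc_z(u) • G(φ z)`.
[cite: VoisinHodgeI2002, §2.2.1] [cite: Shafarevich1994, Ch. IX §3.2] -/
theorem immersive_smul_comp {φ : Ball → Ball} {z : Ball}
    (hφ : MDifferentiableAt 𝓘(ℂ, Fin 2 → ℂ) 𝓘(ℂ, Fin 2 → ℂ) φ z)
    (hφi : Injective (mfderiv 𝓘(ℂ, Fin 2 → ℂ) 𝓘(ℂ, Fin 2 → ℂ) φ z))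
    {c : Ball → ℂ} (hc : MDifferentiableAt 𝓘(ℂ, Fin 2 → ℂ) 𝓘(ℂ, ℂ) c z) (hc0 : c z ≠ 0)
    {G : Ball → EuclideanSpace ℂ (Fin (N + 1))}
    (hG : MDifferentiableAt 𝓘(ℂ, Fin 2 → ℂ) 𝓘(ℂ, EuclideanSpace ℂ (Fin (N + 1))) G (φ z))
    (hP : ∀ (v : TangentSpace 𝓘(ℂ, Fin 2 → ℂ) (φ z)) (r : ℂ),
      mvfderiv 𝓘(ℂ, Fin 2 → ℂ) G (φ z) v = r • G (φ z) → v = 0)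
    (u : TangentSpace 𝓘(ℂ, Fin 2 → ℂ) z) (r : ℂ)
    (h : mvfderiv 𝓘(ℂ, Fin 2 → ℂ) (c • (G ∘ φ)) z u = r • (c • (G ∘ φ)) z) : u = 0 := by
  have hGφ : MDifferentiableAt 𝓘(ℂ, Fin 2 → ℂ) 𝓘(ℂ, EuclideanSpace ℂ (Fin (N + 1))) (G ∘ φ) z := hG.comp z hφ
  have hchain : mvfderiv 𝓘(ℂ, Fin 2 → ℂ) (G ∘ φ) z u =
      mvfderiv 𝓘(ℂ, Fin 2 → ℂ) G (φ z) (mfderiv 𝓘(ℂ, Fin 2 → ℂ) 𝓘(ℂ, Fin 2 → ℂ) φ z u) := by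
    have h' := mfderiv_comp z hG hφ
    exact congrArg (fun L : TangentSpace 𝓘(ℂ, Fin 2 → ℂ) z →L[ℂ]
      TangentSpace 𝓘(ℂ, EuclideanSpace ℂ (Fin (N + 1))) (G (φ z)) ↦
        (show EuclideanSpace ℂ (Fin (N + 1)) from L u)) h'
  have hsmul := congrArg (fun L ↦ L u) (mvfderiv_smul hc hGφ)
  simp only [_root_.add_apply, _root_.smul_apply,
    ContinuousLinearMap.smulRight_apply, Function.comp_apply] at hsmul
  rw [h, hchain, Pi.smul_apply', Function.comp_apply, smul_smul] at hsmul
  -- `hsmul : (r * c z) • G (φ z) = c z • dG (dφ u) + dc u • G (φ z)`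
  have h1 : c z • mvfderiv 𝓘(ℂ, Fin 2 → ℂ) G (φ z) (mfderiv 𝓘(ℂ, Fin 2 → ℂ) 𝓘(ℂ, Fin 2 → ℂ) φ z u) =
      (r * c z - mvfderiv 𝓘(ℂ, Fin 2 → ℂ) c z u) • G (φ z) := by
    rw [sub_smul, hsmul, add_sub_cancel_right]
  have h2 : mvfderiv 𝓘(ℂ, Fin 2 → ℂ) G (φ z) (mfderiv 𝓘(ℂ, Fin 2 → ℂ) 𝓘(ℂ, Fin 2 → ℂ) φ z u) =
      ((c z)⁻¹ * (r * c z - mvfderiv 𝓘(ℂ, Fin 2 → ℂ) c z u)) • G (φ z) := by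
    rw [mul_smul, ← h1, smul_smul, inv_mul_cancel₀ hc0, one_smul]
  exact hφi ((hP _ _ h2).trans (map_zero _).symm)

/-- **An automorphic system immersive at one lift is immersive along the whole orbit**: for `G` of weight `k`
for `Δ` and `δ ∈ Δ`, `G = j(δ, ·)ᵏ • (G ∘ δ)`, so immersivity at `δ z` gives immersivity at `z`.
[cite: Shafarevich1994, Ch. IX §3.2] [cite: Shimura1971, §3.1 Prop. 3.1] -/
theorem immersive_of_immersive_smul {Δ : Subgroup U21} {G : Ball → EuclideanSpace ℂ (Fin (N + 1))}
    (hGh : MDifferentiable 𝓘(ℂ, Fin 2 → ℂ) 𝓘(ℂ, EuclideanSpace ℂ (Fin (N + 1))) G)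
    (hG : G ∈ factorForms Δ (canonicalCocycle (EuclideanSpace ℂ (Fin (N + 1))) k)) {δ : U21} (hδ : δ ∈ Δ)
    {z : Ball}
    (hP : ∀ (v : TangentSpace 𝓘(ℂ, Fin 2 → ℂ) (δ • z)) (r : ℂ),
      mvfderiv 𝓘(ℂ, Fin 2 → ℂ) G (δ • z) v = r • G (δ • z) → v = 0)
    (u : TangentSpace 𝓘(ℂ, Fin 2 → ℂ) z) (r : ℂ) (h : mvfderiv 𝓘(ℂ, Fin 2 → ℂ) G z u = r • G z) : u = 0 := by
  -- automorphy as an identity of functions: `G = jᵏ • (G ∘ δ)`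
  have hGeq : G = (fun w ↦ canonicalFactor δ w ^ k) • (G ∘ fun w : Ball ↦ δ • w) := by
    funext w
    have hw := (mem_factorForms_iff.1 hG) δ hδ w
    rwa [BallForms.canonicalCocycle_apply] at hw
  have hφ : MDifferentiableAt 𝓘(ℂ, Fin 2 → ℂ) 𝓘(ℂ, Fin 2 → ℂ) (fun w : Ball ↦ δ • w) z :=
    ((BallModel.contMDiff_smul δ (n := ω)).mdifferentiable (by simp)) z
  refine immersive_smul_comp hφ (injective_mfderiv_smul δ z)
    (((isHolCocycle_canonicalFactor_pow k).mdifferentiable δ) z) (pow_ne_zero _ (canonicalFactor_ne_zero δ z))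
    (hGh _) hP u r ?_
  rw [← hGeq]
  exact h

/-- **Immersive somewhere on each orbit ⟹ immersive everywhere** for an automorphic system.
[cite: Shafarevich1994, Ch. IX §3.2] -/
theorem immersive_everywhere {Δ : Subgroup U21} [ProperlyDiscontinuousSMul Δ Ball] [IsCancelSMul Δ Ball]
    {G : Ball → EuclideanSpace ℂ (Fin (N + 1))}
    (hGh : MDifferentiable 𝓘(ℂ, Fin 2 → ℂ) 𝓘(ℂ, EuclideanSpace ℂ (Fin (N + 1))) G)
    (hG : G ∈ factorForms Δ (canonicalCocycle (EuclideanSpace ℂ (Fin (N + 1))) k))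
    (himm : ∀ y : orbitRel.Quotient Δ Ball, ∃ z : Ball, QuotientManifold.mk (G := Δ) z = y ∧
      ∀ (u : TangentSpace 𝓘(ℂ, Fin 2 → ℂ) z) (r : ℂ), mvfderiv 𝓘(ℂ, Fin 2 → ℂ) G z u = r • G z → u = 0)
    (z : Ball) (u : TangentSpace 𝓘(ℂ, Fin 2 → ℂ) z) (r : ℂ) (h : mvfderiv 𝓘(ℂ, Fin 2 → ℂ) G z u = r • G z) :
    u = 0 := by
  obtain ⟨z', hz', hP⟩ := himm (QuotientManifold.mk (G := Δ) z)
  obtain ⟨δ, hδz⟩ := QuotientManifold.mk_eq_mk_iff.1 hz'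
  -- `δ • z = z'`
  have hP' : ∀ (v : TangentSpace 𝓘(ℂ, Fin 2 → ℂ) ((δ : U21) • z)) (r : ℂ),
      mvfderiv 𝓘(ℂ, Fin 2 → ℂ) G ((δ : U21) • z) v = r • G ((δ : U21) • z) → v = 0 := by
    rw [show (δ : U21) • z = z' from hδz]
    exact hP
  exact immersive_of_immersive_smul hGh hG δ.2 hP' u r h

/-- **The twist of an immersive system is immersive.** For `G` holomorphic of weight `k` for `Δ₂`, immersive at
some lift of every point of `Δ₂\𝔹²`, and any `g ∈ U(2,1)`, the twisted system `S_g G = j(g, ·)ᵏ • (G ∘ g)` is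
immersive at every point of `𝔹²` — in particular at some lift of every point of `Δ₁\𝔹²`, the hypothesis `himm`
of `BallFS.exists_isKaehler_kaehlerForm_eq_fsForm` / `exists_kaehlerRationalDatum_fsForm` for `S_g G`.
[cite: Shafarevich1994, Ch. IX §3.2] [cite: Shimura1971, §3.1 Prop. 3.1] [cite: VoisinHodgeI2002, §3.3.2 Lemma 3.16] -/
theorem immersive_twist {Δ₁ Δ₂ : Subgroup U21} [ProperlyDiscontinuousSMul Δ₁ Ball] [IsCancelSMul Δ₁ Ball]
    [ProperlyDiscontinuousSMul Δ₂ Ball] [IsCancelSMul Δ₂ Ball]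
    {G : Ball → EuclideanSpace ℂ (Fin (N + 1))}
    (hGh : MDifferentiable 𝓘(ℂ, Fin 2 → ℂ) 𝓘(ℂ, EuclideanSpace ℂ (Fin (N + 1))) G)
    (hG : G ∈ factorForms Δ₂ (canonicalCocycle (EuclideanSpace ℂ (Fin (N + 1))) k))
    (himm : ∀ y : orbitRel.Quotient Δ₂ Ball, ∃ z : Ball, QuotientManifold.mk (G := Δ₂) z = y ∧
      ∀ (u : TangentSpace 𝓘(ℂ, Fin 2 → ℂ) z) (r : ℂ), mvfderiv 𝓘(ℂ, Fin 2 → ℂ) G z u = r • G z → u = 0)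
    (g : U21) :
    ∀ y : orbitRel.Quotient Δ₁ Ball, ∃ z : Ball, QuotientManifold.mk (G := Δ₁) z = y ∧
      ∀ (u : TangentSpace 𝓘(ℂ, Fin 2 → ℂ) z) (r : ℂ),
        mvfderiv 𝓘(ℂ, Fin 2 → ℂ) (twist g G k) z u = r • twist g G k z → u = 0 := by
  intro y
  obtain ⟨z, rfl⟩ := Quotient.exists_rep y
  refine ⟨z, rfl, fun u r h ↦ ?_⟩
  have hφ : MDifferentiableAt 𝓘(ℂ, Fin 2 → ℂ) 𝓘(ℂ, Fin 2 → ℂ) (fun w : Ball ↦ g • w) z :=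
    ((BallModel.contMDiff_smul g (n := ω)).mdifferentiable (by simp)) z
  exact immersive_smul_comp hφ (injective_mfderiv_smul g z)
    (((isHolCocycle_canonicalFactor_pow k).mdifferentiable g) z) (pow_ne_zero _ (canonicalFactor_ne_zero g z))
    (hGh _) (immersive_everywhere hGh hG himm (g • z)) u r h

end BallFS

/-! ### Pull-backs of the Fubini–Study Kähler–rational class along morphisms over translations are Kähler -/

namespace UnitaryBallUniformisationDatum

open Literature.AlgebraicGeometry.HodgeTheory Literature.NumberTheory.Transcendental
open Literature.AlgebraicTopology.SingularHomology (singularCohomology)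

section TwoFrames

variable {X₁ X₂ : Motives.SchemeOver ℂ} (D₁ : UnitaryBallUniformisationDatum 2 X₁)
  (D₂ : UnitaryBallUniformisationDatum 2 X₂) (𝔣₁ : D₁.SylvesterFrame) (𝔣₂ : D₂.SylvesterFrame)
  {N k : ℕ} {G : Ball → EuclideanSpace ℂ (Fin (N + 1))}
  (hGh : MDifferentiable 𝓘(ℂ, Fin 2 → ℂ) 𝓘(ℂ, EuclideanSpace ℂ (Fin (N + 1))) G)
  (hG : G ∈ factorForms (D₂.ballImage 𝔣₂) (BallForms.canonicalCocycle (EuclideanSpace ℂ (Fin (N + 1))) k))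
  (h0 : ∀ z, G z ≠ 0)
  (himm : ∀ y : orbitRel.Quotient (D₂.ballImage 𝔣₂) Ball, ∃ z : Ball,
    QuotientManifold.mk (G := D₂.ballImage 𝔣₂) z = y ∧
      ∀ (u : TangentSpace 𝓘(ℂ, Fin 2 → ℂ) z) (r : ℂ), mvfderiv 𝓘(ℂ, Fin 2 → ℂ) G z u = r • G z → u = 0)
  (f : X₁ ⟶ X₂) {g : U21} (hconj : ∀ δ ∈ D₁.ballImage 𝔣₁, g * δ * g⁻¹ ∈ D₂.ballImage 𝔣₂)
  (hf : ∀ z : Ball, HodgeModel.anMap (D₂.quotModel 𝔣₂) (D₁.quotModel 𝔣₁) f (D₁.quotientSurfaceMk 𝔣₁ z) =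
    D₂.quotientSurfaceMk 𝔣₂ (g • z))

include hGh himm hconj hf in
/-- **The pull-back of a class comparing to a positive multiple of the Fubini–Study form of an immersive system
is a Kähler class.** For `f : X₁ ⟶ X₂` with `f^an (Δ₁ z) = Δ₂ (g z)` and `c ∈ H²(X₂(ℂ); ℂ)` with
`A₂^* c = r · [[G]^*ω_FS] ⊗ 1`, `r > 0`, `G` immersive: `A₁^*(f(ℂ)^* c) = r · [[S_g G]^*ω_FS] ⊗ 1`
(`pullback_map_eq_ofRealClass_fsForm_twist`), `S_g G` is immersive (`BallFS.immersive_twist`), so `[S_g G]^*ω_FS`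
is the Kähler form of a Kähler metric on `Δ₁\𝔹²` (`BallFS.exists_isKaehler_kaehlerForm_eq_fsForm`) and `f(ℂ)^* c`
is a Kähler class of `X₁`. [cite: VoisinHodgeI2002, §3.1.3 and §3.3.2 Lemma 3.16] [cite: Shimura1971, §7.2–7.3] -/
theorem isKaehlerClass_map_of_pullback_eq_smul_fsForm {c : complexBetti X₂ 2} {r : ℝ} (hr : 0 < r)
    (hc : (D₂.quotModel 𝔣₂).pullback 2 c = (r : ℂ) • ofRealClass (D₂.quotientSurface 𝔣₂) 2
      (integrationDeRhamIsoFamily (Fin 2 → ℂ) (D₂.quotientSurface 𝔣₂) 2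
        (deRhamCohomology.mk ⟨BallFS.fsForm G hG h0, BallFS.fsForm_mem_closedSmoothForms hGh hG h0⟩))) :
    IsKaehlerClass 2 X₁ (singularCohomology.map ℂ ℂ (Motives.AlgPoints.mapContinuous (L := ℂ) f) 2 c) := by
  set c' : complexBetti X₂ 2 := ((r : ℂ)⁻¹) • c with hc'
  have hr0 : (r : ℂ) ≠ 0 := by exact_mod_cast hr.ne'
  have hcc : (D₂.quotModel 𝔣₂).pullback 2 c' = ofRealClass (D₂.quotientSurface 𝔣₂) 2
      (integrationDeRhamIsoFamily (Fin 2 → ℂ) (D₂.quotientSurface 𝔣₂) 2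
        (deRhamCohomology.mk ⟨BallFS.fsForm G hG h0, BallFS.fsForm_mem_closedSmoothForms hGh hG h0⟩)) := by
    rw [hc', map_smul, hc, smul_smul, inv_mul_cancel₀ hr0, one_smul]
  have h₁ := D₁.pullback_map_eq_ofRealClass_fsForm_twist D₂ 𝔣₁ 𝔣₂ hGh hG h0 f hconj hf hcc
  -- the Kähler metric on `Δ₁\𝔹²` with Kähler form `[S_g G]^*ω_FS`
  obtain ⟨g₁, hg₁, hg₁ω⟩ := BallFS.exists_isKaehler_kaehlerForm_eq_fsForm (BallFS.mdifferentiable_twist g hGh)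
    (BallFS.twist_mem_factorForms hconj hG) (BallFS.twist_ne_zero g h0) (BallFS.immersive_twist hGh hG himm g)
  have hκ : g₁.kaehlerClass (isSmoothForm_kaehlerForm_of_isManifold_complex_holds
      (E := Fin 2 → ℂ) (M := D₁.quotientSurface 𝔣₁)) hg₁ =
      deRhamCohomology.mk ⟨BallFS.fsForm (BallFS.twist g G k) (BallFS.twist_mem_factorForms hconj hG)
          (BallFS.twist_ne_zero g h0),
        BallFS.fsForm_mem_closedSmoothForms (BallFS.mdifferentiable_twist g hGh) _ _⟩ := by
    unfold Bundle.ContMDiffRiemannianMetric.kaehlerClass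
    congr 1
    exact Subtype.ext hg₁ω
  have hK : (D₁.quotModel 𝔣₁).IsKaehlerClassVia (integrationDeRhamIsoFamily (Fin 2 → ℂ))
      (singularCohomology.map ℂ ℂ (Motives.AlgPoints.mapContinuous (L := ℂ) f) 2 c') :=
    ⟨g₁, hg₁, by rw [h₁, hκ]⟩
  have hK' := (hK.isKaehlerClass integrationDeRhamIsoFamily_isNatural
    integrationDeRhamIsoFamily_isMultiplicative).smul_of_pos hr
  rwa [hc', map_smul, smul_smul, mul_inv_cancel₀ hr0, one_smul] at hK'

end TwoFrames

/-! ### Bookkeeping: one frame for two data with the same Gram matrix -/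

section OneFrame

variable {X₁ X₂ : Motives.SchemeOver ℂ} (D₁ : UnitaryBallUniformisationDatum 2 X₁)
  (D₂ : UnitaryBallUniformisationDatum 2 X₂)

/-- **Conjugation of ball images.** If `g ∈ U(H^{τ₁})` conjugates `Γ₁^{τ₁}` into `Γ₂^{τ₁}` in `GL₃(ℂ)`, then
`ĝ = T⁻¹ g T ∈ U(2,1)` conjugates `Δ₁ = ρ_𝔣(Γ₁)` into `Δ₂ = ρ_𝔣(Γ₂)` (one Sylvester frame `T` for both data).
(Literature copy of the summit-side bookkeeping lemma `CorCM…BallDatum.frameIso_conj_mem_ballImage`.)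
[cite: Shimura1971, §3.1 Prop. 3.1] -/
theorem frameIso_conj_mem_ballImage (hH : D₁.Hℂ = D₂.Hℂ) (𝔣 : D₂.SylvesterFrame) {g : GL (Fin 3) ℂ}
    (hg : g ∈ D₂.realPoints)
    (hΓ : (D₁.Γ.map (Matrix.GeneralLinearGroup.map D₁.τ₁)).map (MulAut.conj g).toMonoidHom ≤
      D₂.Γ.map (Matrix.GeneralLinearGroup.map D₂.τ₁)) :
    ∀ δ ∈ D₁.ballImage (SylvesterFrame.transport hH 𝔣),
      D₂.frameIso 𝔣 ⟨g, hg⟩ * δ * (D₂.frameIso 𝔣 ⟨g, hg⟩)⁻¹ ∈ D₂.ballImage 𝔣 := by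
  intro δ hδ
  obtain ⟨γ₁, rfl⟩ := (D₁.mem_ballImage_iff _).1 hδ
  have hmem : (MulAut.conj g) (Matrix.GeneralLinearGroup.map D₁.τ₁ (γ₁ : GL (Fin 3) D₁.E)) ∈
      D₂.Γ.map (Matrix.GeneralLinearGroup.map D₂.τ₁) :=
    hΓ (Subgroup.mem_map_of_mem _ (Subgroup.mem_map_of_mem _ γ₁.2))
  obtain ⟨γ₂', hγ₂', hγ₂⟩ := Subgroup.mem_map.1 hmem
  refine (D₂.mem_ballImage_iff 𝔣).2 ⟨⟨γ₂', hγ₂'⟩, Subtype.ext ?_⟩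
  have h2 : ((D₂.toRealPoints ⟨γ₂', hγ₂'⟩ : D₂.realPoints) : GL (Fin 3) ℂ) =
      g * Matrix.GeneralLinearGroup.map D₁.τ₁ (γ₁ : GL (Fin 3) D₁.E) * g⁻¹ := by
    rw [show ((D₂.toRealPoints ⟨γ₂', hγ₂'⟩ : D₂.realPoints) : GL (Fin 3) ℂ) =
      Matrix.GeneralLinearGroup.map D₂.τ₁ γ₂' from rfl, hγ₂]
    rfl
  have h1 : ((D₁.toRealPoints γ₁ : D₁.realPoints) : GL (Fin 3) ℂ) =
      Matrix.GeneralLinearGroup.map D₁.τ₁ (γ₁ : GL (Fin 3) D₁.E) := rfl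
  rw [ballRep_apply, ballRep_apply, Subgroup.coe_mul, Subgroup.coe_mul, Subgroup.coe_inv, coe_frameIso,
    coe_frameIso, coe_frameIso, h2, h1, SylvesterFrame.transport_T]
  group

/-- **Lift of a morphism over a translation, in the quotient Hodge models.** If `f : X₁ ⟶ X₂` satisfies
`f(ℂ) (unif₁ v) = unif₂ (g v)` on the negative cone for `g ∈ U(H^{τ₁})` (data with the same Gram matrix, one
frame), then `f^an (Δ₁ z) = Δ₂ (ĝ z)` for `ĝ = T⁻¹ g T ∈ U(2,1)` (`anMap_modelUnif_mulVec` read with `ψ = mk`).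
(Literature copy of the summit-side bookkeeping lemma `CorCM…BallDatum.anMap_quotModel_mk`.)
[cite: Shimura1971, §7.2–7.3] [cite: SerreGAGA1956, §2 n°5 (fonctorialité)] -/
theorem anMap_quotModel_mk (hH : D₁.Hℂ = D₂.Hℂ) (𝔣 : D₂.SylvesterFrame) {g : GL (Fin 3) ℂ}
    (hg : g ∈ D₂.realPoints) (f : X₁ ⟶ X₂)
    (hf : ∀ v ∈ D₁.cone, Motives.AlgPoints.map f (D₁.unif v) = D₂.unif ((g : Matrix (Fin 3) (Fin 3) ℂ) *ᵥ v))
    (z : Ball) :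
    HodgeModel.anMap (D₂.quotModel 𝔣) (D₁.quotModel (SylvesterFrame.transport hH 𝔣)) f
        (D₁.quotientSurfaceMk (SylvesterFrame.transport hH 𝔣) z) =
      D₂.quotientSurfaceMk 𝔣 (D₂.frameIso 𝔣 ⟨g, hg⟩ • z) := by
  rw [← D₁.modelUnif_quotModel, ← D₂.modelUnif_quotModel]
  exact D₂.anMap_modelUnif_mulVec D₁ (D₂.quotModel 𝔣) (D₁.quotModel (SylvesterFrame.transport hH 𝔣)) f 𝔣
    (SylvesterFrame.transport hH 𝔣) rfl hg hf z

end OneFrame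

/-! ### The pinned Kähler class system of a compact ball quotient -/

section Pin

variable {X : Motives.SchemeOver ℂ} (D : UnitaryBallUniformisationDatum 2 X)

/-- **The pinned Kähler class system.** For a compact ball-quotient datum `𝒟` on `X` (`X(ℂ) ≅ Γ\𝔹²`) there is
a Kähler–rational datum `K` of `X` — the Fubini–Study datum of an immersive system of Poincaré series
(`BallProjective.exists_immersive_system`, `exists_kaehlerRationalDatum_fsForm`) — such that, for every datum
`𝒟₁` on `X₁` with the same Gram matrix `H^{τ₁}` and every morphism `f : X₁ ⟶ X` with
`f(ℂ)(unif₁ v) = unif (g v)` on the negative cone, `g ∈ U(H^{τ₁})` conjugating `Γ₁^{τ₁}` into `Γ^{τ₁}`: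
(i) **`f^*(K.η ⊗ 1)` is a Kähler class of `X₁`** (`isKaehlerClass_map_of_pullback_eq_smul_fsForm`: it compares to
`r · [[S_ĝ G]^*ω_FS]`, `S_ĝ G` immersive); (ii) **`f^* K.η = f'^* K.η`** for any second such morphism `f'` over
`v ↦ g' v` (`exists_kaehlerRationalDatum_map_eq`: two systems of one weight have cohomologous Fubini–Study forms).
So `ω_{X₁} := f^* K.η` is a well-defined Kähler class on every level `X₁` below `X` of a tower of Picard modular
surfaces, compatible with level coverings (`g = 1`) and Hecke translates (`g = γ^{ι₁}`).
[cite: VoisinHodgeI2002, §3.1.3, §3.3.2 Lemma 3.16 and §7.1.2] [cite: Shimura1971, §3.1 Prop. 3.1, §7.2–7.3]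
[cite: GriffithsHarrisPrinciples1978, Ch. 1 §2] -/
theorem exists_kaehlerRationalDatum_pull :
    ∃ K : KaehlerRationalDatum 2 X,
      (∀ {X₁ : Motives.SchemeOver ℂ} (D₁ : UnitaryBallUniformisationDatum 2 X₁) (_ : D₁.Hℂ = D.Hℂ)
          {g : GL (Fin 3) ℂ} (_ : g ∈ D.realPoints)
          (_ : (D₁.Γ.map (Matrix.GeneralLinearGroup.map D₁.τ₁)).map (MulAut.conj g).toMonoidHom ≤
            D.Γ.map (Matrix.GeneralLinearGroup.map D.τ₁))
          (f : X₁ ⟶ X)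
          (_ : ∀ v ∈ D₁.cone, Motives.AlgPoints.map f (D₁.unif v) = D.unif ((g : Matrix (Fin 3) (Fin 3) ℂ) *ᵥ v)),
          IsKaehlerClass 2 X₁ (ofRatClass (Motives.ComplexPoints X₁) 2 (BettiUniverse.pull f 2 K.η))) ∧
      ∀ {X₁ : Motives.SchemeOver ℂ} (D₁ : UnitaryBallUniformisationDatum 2 X₁) (_ : D₁.Hℂ = D.Hℂ)
          {g g' : GL (Fin 3) ℂ} (_ : g ∈ D.realPoints) (_ : g' ∈ D.realPoints)
          (_ : (D₁.Γ.map (Matrix.GeneralLinearGroup.map D₁.τ₁)).map (MulAut.conj g).toMonoidHom ≤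
            D.Γ.map (Matrix.GeneralLinearGroup.map D.τ₁))
          (_ : (D₁.Γ.map (Matrix.GeneralLinearGroup.map D₁.τ₁)).map (MulAut.conj g').toMonoidHom ≤
            D.Γ.map (Matrix.GeneralLinearGroup.map D.τ₁))
          (f f' : X₁ ⟶ X)
          (_ : ∀ v ∈ D₁.cone, Motives.AlgPoints.map f (D₁.unif v) = D.unif ((g : Matrix (Fin 3) (Fin 3) ℂ) *ᵥ v))
          (_ : ∀ v ∈ D₁.cone, Motives.AlgPoints.map f' (D₁.unif v) = D.unif ((g' : Matrix (Fin 3) (Fin 3) ℂ) *ᵥ v)),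
          BettiUniverse.pull f 2 K.η = BettiUniverse.pull f' 2 K.η := by
  obtain ⟨𝔣⟩ := D.nonempty_sylvesterFrame
  obtain ⟨N, k, G, hN, -, hGh, hG, h0, himm⟩ := BallProjective.exists_immersive_system (D.ballImage 𝔣)
  obtain ⟨K, r, hr, hK⟩ := D.exists_kaehlerRationalDatum_fsForm 𝔣 hGh hG h0 himm hN
  refine ⟨K, fun D₁ hH g hg hΓ f hf ↦ ?_, fun D₁ hH g g' hg hg' hΓ hΓ' f f' hf hf' ↦ ?_⟩
  · -- (i) Kählerness of the pull-back
    have h := D₁.isKaehlerClass_map_of_pullback_eq_smul_fsForm D (SylvesterFrame.transport hH 𝔣) 𝔣 hGh hG h0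
      himm f (D₁.frameIso_conj_mem_ballImage D hH 𝔣 hg hΓ) (D₁.anMap_quotModel_mk D hH 𝔣 hg f hf) hr hK
    rw [ofRatClass, coeffClass_map]
    exact h
  · -- (ii) independence of the morphism: both pull-backs compare to cohomologous Fubini–Study forms
    set c : complexBetti X 2 := ((r : ℂ)⁻¹) • ofRatClass _ 2 K.η with hc
    have hr0 : (r : ℂ) ≠ 0 := by exact_mod_cast hr.ne'
    have hcc : (D.quotModel 𝔣).pullback 2 c = ofRealClass (D.quotientSurface 𝔣) 2
        (integrationDeRhamIsoFamily (Fin 2 → ℂ) (D.quotientSurface 𝔣) 2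
          (deRhamCohomology.mk ⟨BallFS.fsForm G hG h0, BallFS.fsForm_mem_closedSmoothForms hGh hG h0⟩)) := by
      rw [hc, map_smul, hK, smul_smul, inv_mul_cancel₀ hr0, one_smul]
    have hconj := D₁.frameIso_conj_mem_ballImage D hH 𝔣 hg hΓ
    have hconj' := D₁.frameIso_conj_mem_ballImage D hH 𝔣 hg' hΓ'
    have h₁ := D₁.pullback_map_eq_ofRealClass_fsForm_twist D (SylvesterFrame.transport hH 𝔣) 𝔣 hGh hG h0 f hconj
      (D₁.anMap_quotModel_mk D hH 𝔣 hg f hf) hcc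
    have h₂ := D₁.pullback_map_eq_ofRealClass_fsForm_twist D (SylvesterFrame.transport hH 𝔣) 𝔣 hGh hG h0 f' hconj'
      (D₁.anMap_quotModel_mk D hH 𝔣 hg' f' hf') hcc
    rw [BallFS.deRhamCohomology_mk_fsForm_eq (BallFS.mdifferentiable_twist _ hGh)
      (BallFS.twist_mem_factorForms hconj hG) (BallFS.twist_ne_zero _ h0) (BallFS.mdifferentiable_twist _ hGh)
      (BallFS.twist_mem_factorForms hconj' hG) (BallFS.twist_ne_zero _ h0), ← h₂] at h₁
    have h₃ := (D₁.quotModel (SylvesterFrame.transport hH 𝔣)).pullback_injective 2 h₁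
    rw [hc, map_smul, map_smul] at h₃
    have h₄ := smul_right_injective _ (inv_ne_zero hr0) h₃
    apply ofRatClass_injective 2
    rw [ofRatClass, coeffClass_map, coeffClass_map]
    exact h₄

end Pin

end UnitaryBallUniformisationDatum

end Literature.AlgebraicGeometry.ShimuraVarieties

end
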